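import Mathlib
import Summits.AtomisticToContinuum.Crystallization.Theses.BrittleRungDescent
import Summits.AtomisticToContinuum.Crystallization.Theses.HullMinimality
import Summits.AtomisticToContinuum.Crystallization.Theses.PhononSlackCertificates
import Summits.AtomisticToContinuum.Crystallization.Theses.LaminarSixThreeThree
import Summits.AtomisticToContinuum.Crystallization.Theorems.HullMinimalityHullCriterionConverse
import Summits.AtomisticToContinuum.Crystallization.Theorems.PhononSlackCertificatesWindowOptimality
import Summits.AtomisticToContinuum.Crystallization.Theorems.PhononSlackCertificatesNearFarGlueRRouteNeeds
import Summits.AtomisticToContinuum.Crystallization.Theorems.ChessboardParticlePlanesPeriodicWindowsOfBarlowWindows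
import Literature.Geometry.DiscreteGeometry.TwoShellPatterns
import Literature.MathematicalPhysics.StatisticalMechanics.LennardJonesClusters

/-!
# `BrittleRungDescent.LJBarlowRigidity` (stmt-AtomisticToContinuum-9206) — SPLIT GLUE and landed-glue corollaries

Helper file for the crux `LJBarlowRigidity := H → Crystallization` of route `BrittleRungDescent` (strategist
decomposition, `--supports stmt-AtomisticToContinuum-9206`).  Everything here is bookkeeping over LANDED theorems:

* `crystallization_of_isCrystallizing_lj` — the sub-problem follows from its positional conjunct alone
  (`hullCriterionConverse_proof` 11780, `windowOptimality_proof` 13962, `CrysEnergyLimit_holds` 0626,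
  `LennardJonesGroundStatesExist_holds`); `crystallization_iff_isCrystallizing_lj`.
* `crystallization_of_laminarBarlowWindows` — item 14292 (`LaminarSixThreeThree.LaminarBarlowWindows`) alone
  decides the sub-problem (`PeriodicWindowsSketch.PeriodicWindows_of_laminarBarlowWindows`, `stub_hullCriterion`).
* `LJBarlowRigidity_of_subs` — THE SPLIT: the crux from three sub-statements under its own hypothesis `H`
  (scale window; two-shell goodness of a soft-truss vertex; local `η`-flatness a.e.), via the landed
  `PhononSlackCertificatesNearFarGlueR.crystallization_of_fractions`.  The three antecedents are written inline
  (VERBATIM the children `LJScaleWindow`, `LJTwoShellGood`, `LJLocalFlatness` the strategist files on the route: `IsTwoShellGood` and `PrestressSplitKorn.LayeredNear` are written out over route-importable vocabulary, `Iff.rfl` to the named predicates — see the two `example`s).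
* `LJBarlowRigidity_of_laminarBarlowWindowsUnderH` — the crux from birth's first stub alone.

All `[folklore]`.
-/

noncomputable section

namespace Summit.AtomisticToContinuum.Crystallization.Theorems.BrittleRungDescentLJBarlowRigiditySplit

open Filter
open scoped Classical

/-- **`IsCrystallizing lennardJones 3 → Crystallization`** (landed glue: converse hull criterion, window
optimality, energy limit, existence of ground states). [folklore] -/
theorem crystallization_of_isCrystallizing_lj
    (h : Literature.MathematicalPhysics.StatisticalMechanics.IsCrystallizing Literature.MathematicalPhysics.StatisticalMechanics.lennardJones 3) : _root_.Crystallization := by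
  have hPW : Summit.AtomisticToContinuum.Crystallization.Theses.HullMinimality.PeriodicWindows :=
    Summit.AtomisticToContinuum.Crystallization.Theorems.hullCriterionConverse_proof h
  have hWO := Summit.AtomisticToContinuum.Crystallization.Theorems.windowOptimality_proof
  unfold Summit.AtomisticToContinuum.Crystallization.Theses.PhononSlackCertificates.WindowOptimality
    at hWO
  obtain ⟨x, hx⟩ : ∃ x : (N : ℕ) → (Fin N → EuclideanSpace ℝ (Fin 3)), ∀ N, Literature.MathematicalPhysics.StatisticalMechanics.IsGroundState Literature.MathematicalPhysics.StatisticalMechanics.lennardJones (x N) :=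
    ⟨fun N => (Literature.MathematicalPhysics.StatisticalMechanics.LennardJonesGroundStatesExist_holds N).choose,
      fun N => (Literature.MathematicalPhysics.StatisticalMechanics.LennardJonesGroundStatesExist_holds N).choose_spec⟩
  obtain ⟨P, hP⟩ := hPW x hx
  have hleast : IsLeast (Set.range fun Q : Literature.MathematicalPhysics.StatisticalMechanics.PeriodicConfiguration 3 =>
      Q.energyPerParticle Literature.MathematicalPhysics.StatisticalMechanics.lennardJones) (P.energyPerParticle Literature.MathematicalPhysics.StatisticalMechanics.lennardJones) :=
    hWO x hx P hP
  have hinf : (⨅ Q : Literature.MathematicalPhysics.StatisticalMechanics.PeriodicConfiguration 3, Q.energyPerParticle Literature.MathematicalPhysics.StatisticalMechanics.lennardJones) =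
      P.energyPerParticle Literature.MathematicalPhysics.StatisticalMechanics.lennardJones := hleast.csInf_eq
  have h0 := Summit.AtomisticToContinuum.Crystallization.Theses.LaminarSixThreeThree.CrysEnergyLimit_holds
  unfold Summit.AtomisticToContinuum.Crystallization.Theses.LaminarSixThreeThree.CrysEnergyLimit at h0
  rw [hinf] at h0
  exact ⟨⟨P, hleast, h0⟩, h⟩

/-- The sub-problem is equivalent to its positional conjunct. [folklore] -/
theorem crystallization_iff_isCrystallizing_lj :
    _root_.Crystallization ↔ Literature.MathematicalPhysics.StatisticalMechanics.IsCrystallizing Literature.MathematicalPhysics.StatisticalMechanics.lennardJones 3 :=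
  ⟨fun h => h.2, crystallization_of_isCrystallizing_lj⟩

/-- **Item 14292 alone decides the sub-problem**: `LaminarBarlowWindows → Crystallization`. [folklore] -/
theorem crystallization_of_laminarBarlowWindows
    (h : Summit.AtomisticToContinuum.Crystallization.Theses.LaminarSixThreeThree.LaminarBarlowWindows) :
    _root_.Crystallization :=
  crystallization_of_isCrystallizing_lj
    (Summit.AtomisticToContinuum.Crystallization.Theorems.PrestressSplitKorn.stub_hullCriterion
      (Summit.AtomisticToContinuum.Crystallization.Theorems.PeriodicWindowsSketch.PeriodicWindows_of_laminarBarlowWindows h))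

/-- The crux from birth's first stub alone (`H → LaminarBarlowWindows`). [folklore] -/
theorem LJBarlowRigidity_of_laminarBarlowWindowsUnderH
    (h1 : (∃ a : ℝ, 0 < a ∧ ∀ x : (N : ℕ) → (Fin N → EuclideanSpace ℝ (Fin 3)), (∀ N, Literature.MathematicalPhysics.StatisticalMechanics.IsGroundState Literature.MathematicalPhysics.StatisticalMechanics.lennardJones (x N)) → Filter.Tendsto (fun N : ℕ => (Nat.card {i : Fin N // ¬ ∀ j : Fin N, dist (x N i) (x N j) ≤ 4 * a → (((∀ l : Fin N, l ≠ j → a * (1 - 1 / 400) ≤ dist (x N j) (x N l) ∧ (dist (x N j) (x N l) ≤ a * (1 + 1 / 400) ∨ 63 / 50 * a ≤ dist (x N j) (x N l))) ∧ Nat.card {l : Fin N // l ≠ j ∧ dist (x N j) (x N l) ≤ a * (1 + 1 / 400)} = 12) ∧ ((∃ e : {k : Fin N // k ≠ j ∧ dist (x N j) (x N k) ≤ a * (1 + 1 / 400)} ≃ {q : EuclideanSpace ℝ (Fin 3) // q ∈ Literature.Geometry.DiscreteGeometry.fccKissingPattern}, ∀ k k' : {k : Fin N // k ≠ j ∧ dist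 (x N j) (x N k) ≤ a * (1 + 1 / 400)}, k ≠ k' → (dist (x N k.1) (x N k'.1) ≤ a * (1 + 1 / 400) ↔ dist (e k).1 (e k').1 = 1)) ∨ (∃ e : {k : Fin N // k ≠ j ∧ dist (x N j) (x N k) ≤ a * (1 + 1 / 400)} ≃ {q : EuclideanSpace ℝ (Fin 3) // q ∈ Literature.Geometry.DiscreteGeometry.hcpKissingPattern}, ∀ k k' : {k : Fin N // k ≠ j ∧ dist (x N j) (x N k) ≤ a * (1 + 1 / 400)}, k ≠ k' → (dist (x N k.1) (x N k'.1) ≤ a * (1 + 1 / 400) ↔ dist (e k).1 (e k').1 = 1))))} : ℝ) / N) Filter.atTop (nhds 0)) → Summit.AtomisticToContinuum.Crystallization.Theses.LaminarSixThreeThree.LaminarBarlowWindows) :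
    Summit.AtomisticToContinuum.Crystallization.Theses.BrittleRungDescent.LJBarlowRigidity :=
  fun hH => crystallization_of_laminarBarlowWindows (h1 hH)

/-- Counting glue: `Nat.card` of complementary subtypes is antitone under a pointwise implication. [folklore] -/
theorem natCard_not_mono {N : ℕ} {B G : Fin N → Prop} (h : ∀ i, B i → G i) :
    Nat.card {i : Fin N // ¬ G i} ≤ Nat.card {i : Fin N // ¬ B i} :=
  Nat.card_le_card_of_injective
    (fun p : {i : Fin N // ¬ G i} => (⟨p.1, fun hB => p.2 (h p.1 hB)⟩ : {i : Fin N // ¬ B i}))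
    (by
      intro p q hpq
      simp only [Subtype.mk.injEq] at hpq
      exact Subtype.ext hpq)

/-- Density glue: `B`-bad density `→ 0` and `B ⇒ G` pointwise give `G`-bad density `→ 0`. [folklore] -/
theorem tendsto_density_mono (B G : (N : ℕ) → Fin N → Prop) (h : ∀ N i, B N i → G N i)
    (hB : Filter.Tendsto (fun N : ℕ => (Nat.card {i : Fin N // ¬ B N i} : ℝ) / N) Filter.atTop (nhds 0)) :
    Filter.Tendsto (fun N : ℕ => (Nat.card {i : Fin N // ¬ G N i} : ℝ) / N) Filter.atTop (nhds 0) := by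
  refine squeeze_zero (fun N => by positivity) (fun N => ?_) hB
  gcongr
  exact_mod_cast natCard_not_mono (h N)


/-- Child 2's conclusion is `IsTwoShellGood (1/20) (47/50) 1 x i`, definitionally. [folklore] -/
example (N : ℕ) (x : Fin N → EuclideanSpace ℝ (Fin 3)) (i : Fin N) :
    (∃ b : ℝ, 47 / 50 ≤ b ∧ b ≤ 1 ∧ ∃ (A : EuclideanSpace ℝ (Fin 3) →ₗᵢ[ℝ] EuclideanSpace ℝ (Fin 3)) (P : Finset (EuclideanSpace ℝ (Fin 3))) (f : EuclideanSpace ℝ (Fin 3) → Fin N), (P = Literature.Geometry.DiscreteGeometry.scaledPattern (Literature.Geometry.DiscreteGeometry.fccInt ∪ {![2, 0, 0], ![-2, 0, 0], ![0, 2, 0], ![0, -2, 0], ![0, 0, 2], ![0, 0, -2]}) 2 ∨ P = Literature.Geometry.DiscreteGeometry.scaledPattern (Literature.Geometry.DiscreteGeometry.hcpInt ∪ {![6, 0, 0], ![0, 6, 0], ![0, 0, 6], ![2, -4, -4], ![-4, 2, -4], ![-4, -4, 2]}) 18) ∧ (∀ v ∈ P, f v ≠ i ∧ dist (x (f v)) (x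 i + b • A v) ≤ 1 / 20 * b) ∧ Set.InjOn f ↑P ∧ ∀ j : Fin N, j ≠ i → dist (x j) (x i) ≤ 3 / 2 * b → ∃ v ∈ P, f v = j) ↔ Literature.Geometry.DiscreteGeometry.IsTwoShellGood (1 / 20) (47 / 50) 1 x i := Iff.rfl

/-- **THE SPLIT** `LJBarlowRigidity_of_subs : LJScaleWindow → LJTwoShellGood → LJLocalFlatness → LJBarlowRigidity`
(children written inline): under `H` take its scale `a`; the window; two-shell goodness a.e. by counting; local
flatness a.e.; then the landed `crystallization_of_fractions`. [folklore] -/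
theorem LJBarlowRigidity_of_subs
    (h1 : ∀ a : ℝ, 0 < a → (∀ x : (N : ℕ) → (Fin N → EuclideanSpace ℝ (Fin 3)), (∀ N, Literature.MathematicalPhysics.StatisticalMechanics.IsGroundState Literature.MathematicalPhysics.StatisticalMechanics.lennardJones (x N)) → Filter.Tendsto (fun N : ℕ => (Nat.card {i : Fin N // ¬ ∀ j : Fin N, dist (x N i) (x N j) ≤ 4 * a → (((∀ l : Fin N, l ≠ j → a * (1 - 1 / 400) ≤ dist (x N j) (x N l) ∧ (dist (x N j) (x N l) ≤ a * (1 + 1 / 400) ∨ 63 / 50 * a ≤ dist (x N j) (x N l))) ∧ Nat.card {l : Fin N // l ≠ j ∧ dist (x N j) (x N l) ≤ a * (1 + 1 / 400)} = 12) ∧ ((∃ e : {k : Fin N // k ≠ j ∧ dist (x N j) (x N k) ≤ a * (1 + 1 / 400)} ≃ {q : EuclideanSpace ℝ (Fin 3) // q ∈ Literature.Geometry.DiscreteGeometry.fccKissingPattern}, ∀ k k' : {k : Fin N // k ≠ j ∧ dist (x N j) (x N k) ≤ a * (1 + 1 / 400)}, k ≠ k' → (dist (x N k.1) (x N k'.1)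 ≤ a * (1 + 1 / 400) ↔ dist (e k).1 (e k').1 = 1)) ∨ (∃ e : {k : Fin N // k ≠ j ∧ dist (x N j) (x N k) ≤ a * (1 + 1 / 400)} ≃ {q : EuclideanSpace ℝ (Fin 3) // q ∈ Literature.Geometry.DiscreteGeometry.hcpKissingPattern}, ∀ k k' : {k : Fin N // k ≠ j ∧ dist (x N j) (x N k) ≤ a * (1 + 1 / 400)}, k ≠ k' → (dist (x N k.1) (x N k'.1) ≤ a * (1 + 1 / 400) ↔ dist (e k).1 (e k').1 = 1))))} : ℝ) / N) Filter.atTop (nhds 0)) → 943 / 1000 ≤ a ∧ a ≤ 997 / 1000)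
    (h2 : ∀ a : ℝ, 943 / 1000 ≤ a → a ≤ 997 / 1000 → ∀ (N : ℕ) (x : Fin N → EuclideanSpace ℝ (Fin 3)) (i : Fin N), Function.Injective x → (∀ j : Fin N, dist (x i) (x j) ≤ 4 * a → (((∀ l : Fin N, l ≠ j → a * (1 - 1 / 400) ≤ dist (x j) (x l) ∧ (dist (x j) (x l) ≤ a * (1 + 1 / 400) ∨ 63 / 50 * a ≤ dist (x j) (x l))) ∧ Nat.card {l : Fin N // l ≠ j ∧ dist (x j) (x l) ≤ a * (1 + 1 / 400)} = 12) ∧ ((∃ e : {k : Fin N // k ≠ j ∧ dist (x j) (x k) ≤ a * (1 + 1 / 400)} ≃ {q : EuclideanSpace ℝ (Fin 3) // q ∈ Literature.Geometry.DiscreteGeometry.fccKissingPattern}, ∀ k k' : {k : Fin N // k ≠ j ∧ dist (x j) (x k) ≤ a * (1 + 1 / 400)}, k ≠ k' → (dist (x k.1) (x k'.1) ≤ a * (1 + 1 / 400) ↔ dist (e k).1 (e k').1 = 1)) ∨ (∃ e : {k : Fin N // k ≠ j ∧ dist (x j) (x k) ≤ a * (1 + 1 / 400)} ≃ {q : EuclideanSpace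 ℝ (Fin 3) // q ∈ Literature.Geometry.DiscreteGeometry.hcpKissingPattern}, ∀ k k' : {k : Fin N // k ≠ j ∧ dist (x j) (x k) ≤ a * (1 + 1 / 400)}, k ≠ k' → (dist (x k.1) (x k'.1) ≤ a * (1 + 1 / 400) ↔ dist (e k).1 (e k').1 = 1))))) → ∃ b : ℝ, 47 / 50 ≤ b ∧ b ≤ 1 ∧ ∃ (A : EuclideanSpace ℝ (Fin 3) →ₗᵢ[ℝ] EuclideanSpace ℝ (Fin 3)) (P : Finset (EuclideanSpace ℝ (Fin 3))) (f : EuclideanSpace ℝ (Fin 3) → Fin N), (P = Literature.Geometry.DiscreteGeometry.scaledPattern (Literature.Geometry.DiscreteGeometry.fccInt ∪ {![2, 0, 0], ![-2, 0, 0], ![0, 2, 0], ![0, -2, 0], ![0, 0, 2], ![0, 0, -2]}) 2 ∨ P = Literature.Geometry.DiscreteGeometry.scaledPattern (Literature.Geometry.DiscreteGeometry.hcpInt ∪ {![6, 0, 0], ![0, 6, 0], ![0, 0, 6], ![2, -4, -4], ![-4, 2, -4], ![-4, -4, 2]}) 18) ∧ (∀ v ∈ P, f v ≠ i ∧ dist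 (x (f v)) (x i + b • A v) ≤ 1 / 20 * b) ∧ Set.InjOn f ↑P ∧ ∀ j : Fin N, j ≠ i → dist (x j) (x i) ≤ 3 / 2 * b → ∃ v ∈ P, f v = j)
    (h3 : ∀ a : ℝ, 943 / 1000 ≤ a → a ≤ 997 / 1000 → (∀ x : (N : ℕ) → (Fin N → EuclideanSpace ℝ (Fin 3)), (∀ N, Literature.MathematicalPhysics.StatisticalMechanics.IsGroundState Literature.MathematicalPhysics.StatisticalMechanics.lennardJones (x N)) → Filter.Tendsto (fun N : ℕ => (Nat.card {i : Fin N // ¬ ∀ j : Fin N, dist (x N i) (x N j) ≤ 4 * a → (((∀ l : Fin N, l ≠ j → a * (1 - 1 / 400) ≤ dist (x N j) (x N l) ∧ (dist (x N j) (x N l) ≤ a * (1 + 1 / 400) ∨ 63 / 50 * a ≤ dist (x N j) (x N l))) ∧ Nat.card {l : Fin N // l ≠ j ∧ dist (x N j) (x N l) ≤ a * (1 + 1 / 400)} = 12) ∧ ((∃ e : {k : Fin N // k ≠ j ∧ dist (x N j) (x N k) ≤ a * (1 + 1 / 400)} ≃ {q : EuclideanSpace ℝ (Fin 3) // q ∈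 Literature.Geometry.DiscreteGeometry.fccKissingPattern}, ∀ k k' : {k : Fin N // k ≠ j ∧ dist (x N j) (x N k) ≤ a * (1 + 1 / 400)}, k ≠ k' → (dist (x N k.1) (x N k'.1) ≤ a * (1 + 1 / 400) ↔ dist (e k).1 (e k').1 = 1)) ∨ (∃ e : {k : Fin N // k ≠ j ∧ dist (x N j) (x N k) ≤ a * (1 + 1 / 400)} ≃ {q : EuclideanSpace ℝ (Fin 3) // q ∈ Literature.Geometry.DiscreteGeometry.hcpKissingPattern}, ∀ k k' : {k : Fin N // k ≠ j ∧ dist (x N j) (x N k) ≤ a * (1 + 1 / 400)}, k ≠ k' → (dist (x N k.1) (x N k'.1) ≤ a * (1 + 1 / 400) ↔ dist (e k).1 (e k').1 = 1))))} : ℝ) / N) Filter.atTop (nhds 0)) → ∀ x : (N : ℕ) → (Fin N → EuclideanSpace ℝ (Fin 3)), (∀ N, Literature.MathematicalPhysics.StatisticalMechanics.IsGroundState Literature.MathematicalPhysics.StatisticalMechanics.lennardJones (x N)) → ∀ η : ℝ, 0 < η → Filter.Tendsto (fun N : ℕ => ((Finset.univ.filter fun i : Fin N => ¬ (∃ (A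 : EuclideanSpace ℝ (Fin 3) →ₗᵢ[ℝ] EuclideanSpace ℝ (Fin 3)) (t : EuclideanSpace ℝ (Fin 3)) (b : ℝ) (s : ℤ → ℤ) (z : ℤ → ℝ), (47 / 50 ≤ b ∧ b ≤ 1 ∧ ∀ m : ℤ, 39 / 50 * b ≤ z (m + 1) - z m ∧ z (m + 1) - z m ≤ 17 / 20 * b) ∧ Literature.MathematicalPhysics.StatisticalMechanics.IsHaggSeq s ∧ ((∀ j : Fin N, dist (x N j) (x N i) ≤ 2 → ∃ p ∈ Set.range fun l : ℤ × ℤ × ℤ => A ((((l.2.1 : ℝ) • Literature.MathematicalPhysics.StatisticalMechanics.triangularVec₁ b) + ((l.2.2 : ℝ) • Literature.MathematicalPhysics.StatisticalMechanics.triangularVec₂ b)) + ((Literature.MathematicalPhysics.StatisticalMechanics.haggLabel s l.1 : ℝ) • Literature.MathematicalPhysics.StatisticalMechanics.barlowOffset b) + (z l.1 • Literature.MathematicalPhysics.StatisticalMechanics.layerNormal 1)), dist (x N j + t) p ≤ η) ∧ (∀ p ∈ Set.range fun l : ℤ × ℤ × ℤ => A ((((l.2.1 : ℝ) • Literature.MathematicalPhysics.StatisticalMechanics.triangularVec₁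 b) + ((l.2.2 : ℝ) • Literature.MathematicalPhysics.StatisticalMechanics.triangularVec₂ b)) + ((Literature.MathematicalPhysics.StatisticalMechanics.haggLabel s l.1 : ℝ) • Literature.MathematicalPhysics.StatisticalMechanics.barlowOffset b) + (z l.1 • Literature.MathematicalPhysics.StatisticalMechanics.layerNormal 1)), dist p (x N i + t) ≤ 2 → ∃ j : Fin N, dist (x N j + t) p ≤ η)))).card : ℝ) / N) Filter.atTop (nhds 0)) :
    Summit.AtomisticToContinuum.Crystallization.Theses.BrittleRungDescent.LJBarlowRigidity := by
  unfold Summit.AtomisticToContinuum.Crystallization.Theses.BrittleRungDescent.LJBarlowRigidity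
  rintro ⟨a, ha, hH⟩
  obtain ⟨hlo, hhi⟩ := h1 a ha hH
  refine Summit.AtomisticToContinuum.Crystallization.Theorems.PhononSlackCertificatesNearFarGlueR.crystallization_of_fractions ?_ ?_
  · intro x hx
    exact tendsto_density_mono _ _ (fun N i hB => h2 a hlo hhi N (x N) i (hx N).1 hB) (hH x hx)
  · intro x hx η hη
    exact h3 a hlo hhi hH x hx η hη

end Summit.AtomisticToContinuum.Crystallization.Theorems.BrittleRungDescentLJBarlowRigiditySplit

end
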